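import Summits.NavierStokesRegularity.OSWSelfSimilar.SheetREvenEnergySpaceOf
import Summits.NavierStokesRegularity.OSWSelfSimilar.SheetRGeneratorOddDense
import HarnessLib

/-!
# SHEET-ℝ frame, EVEN ZERO-MASS class `E⁺₀`: the even zero-mass CORRECTION of an `L²_w` class, the SMOOTH density lemma in `WevenZ`, and the weak local
# operator on a smooth profile against PARITY-FREE tests — the three inputs of `SheetRGeneratorEvenDense` (density of `D(T⁺)`)

HONEST FRAMING (cell ns-blowup GROUP B / zone Z3, case Z3-SR-SPEC EVEN half, P-list (P9)⁺ «C₀-semigroup generation on the even zero-mass class»; 1-D MODEL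
certificate frame (viscous gCLM/OSW sheet on the line); not Euler/NS; «violates: none — MODEL»).  Nothing here asserts that a profile exists; no hypothesis structure
is used (pure real analysis on selfsim g14's even classes).  Twin of §§1–3 of profile-cert-5 g7's `SheetRGeneratorOddDense`.
CONTENT.
* §0 the normalised bump of `SheetREvenTestsBump` is `C^∞` (`smoothTransition ∘ polynomial`); even `C_c^∞` profiles are even tests.
* §1 THE EVEN ZERO-MASS CORRECTION of an `L²_w` class `g`: `g_e − (L/π)·(∫g_e)·w⁻¹` with `g_e = ½(g + g∘(−·))` and `w⁻¹ = (L² + ξ²)⁻¹ ∈ L²_w` — it lies in `WevenZ`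
  (`evenZ_correction_mem`) and pairs with every ZERO-MASS even test exactly as `g` does (`integral_weight_correction_mul_test`: the weight is even and
  `∫ w·w⁻¹·v = ∫ v = 0`).  Written out, no definition.
* §2 `eq_zero_of_mem_WevenZ_smooth` — density, smooth form: `g ∈ WevenZ` with `∫ w g φ = 0` for every even ZERO-MASS `φ ∈ C_c^∞` is `0` (selfsim's
  `eq_zero_of_mem_WevenZ` with the defect device run on smooth tests: `φ − (∫φ)·bump` is smooth).
* §3 `linForm_smooth_eq_integral_any` — for `φ ∈ C²` with compact support and a PARITY-FREE compactly supported test: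
  `linForm L d V φ φ′ v v₁ = ∫ w·(−φ″ + dφ′ + Vφ)·v` (cert-5's `integral_deriv_mul_testAny`).
No definition, no named fact.  WHAT THIS IS NOT: not NS; no number of record moves.
-/

noncomputable section

namespace Summit.NavierStokesRegularity.OSWSelfSimilar
namespace SheetREvenZeroMassCorrection


open _root_.MeasureTheory _root_.Set _root_.Filter _root_.Real Literature.Analysis.Fourier SheetRWeakProfilePV SheetRWeakToStrong
  SheetREnergyClass SheetRWeightedMeasure SheetREnergySpace SheetRLinearisedTests SheetRTestSpace SheetRLinearisedFormBounds
  SheetRComplexPivot SheetROddClass SheetREvenTests SheetREvenEnergySpace SheetREvenForms SheetREvenPairUniqueness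
  SheetREvenClass SheetRResolventEvenClass SheetRGeneratorEvenWeak SheetREvenEnergySpaceOf SheetRGeneratorOddDense SheetRWeakEigenReal
  SheetRSpectrumOddAssemblyReal Literature.Analysis.OperatorTheory Complex
open scoped Topology ENNReal InnerProductSpace ContDiff


variable {L : ℝ}

/-! ### §0 Smoothness of the cutoff and of the normalised bump; even smooth profiles are even tests -/

/-- The normalised bump `ρ = χ₁/∫χ₁` is smooth (the cutoff `χ_R = smoothTransition (2 − ξ²/R²)` of `SheetRLinearisedTests` is `C^n` for every `n`;
inlined — a separate statement would read textually like `Literature.Analysis.Calculus.contDiff_cutoff`, which is about a DIFFERENT cutoff). [folklore] -/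
theorem contDiff_bumpFun {n : ℕ∞} : ContDiff ℝ n bumpFun := by
  have h : ContDiff ℝ n fun ξ : ℝ => 2 - ‖ξ‖ ^ 2 / (1 : ℝ) ^ 2 := contDiff_const.sub ((contDiff_norm_sq ℝ).div_const _)
  have hχ : ContDiff ℝ n (cutoff 1) := (Real.smoothTransition.contDiff (n := n)).comp h
  have e : bumpFun = fun ξ => cutoff 1 ξ * (∫ y, cutoff 1 y)⁻¹ := by funext ξ; rw [bumpFun, div_eq_mul_inv]
  rw [e]; exact hχ.mul contDiff_const

/-- The normalised bump has compact support. [folklore] -/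
theorem hasCompactSupport_bumpFun : HasCompactSupport bumpFun := by
  refine HasCompactSupport.intro (isCompact_Icc : IsCompact (Icc (-2 : ℝ) 2)) fun x hx => ?_
  have : 2 * (1 : ℝ) ≤ |x| := by
    simp only [mem_Icc, not_and_or, not_le] at hx
    rcases hx with hx | hx
    · linarith [neg_abs_le x]
    · linarith [le_abs_self x]
  simp [bumpFun, (cutoff_and_deriv_eq_zero one_pos this).1]

/-- The normalised bump is even. [folklore] -/
theorem bumpFun_even (y : ℝ) : bumpFun (-y) = bumpFun y := by simp only [bumpFun, cutoff_neg]

/-- An even `φ ∈ C_c^∞` with its derivative is an even test. [folklore] -/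
theorem isCompactTestE_of_smooth_even {φ : ℝ → ℝ} (hφ : ContDiff ℝ ∞ φ) (hφc : HasCompactSupport φ) (heven : ∀ y, φ (-y) = φ y) :
    IsCompactTestE φ (deriv φ) := by
  have h := isCompactTestE_evenPart (hφ.of_le (by exact_mod_cast le_top)) hφc
  have e : (fun x => (φ x + φ (-x)) / 2) = φ := by funext x; rw [heven x]; ring
  rwa [e] at h

/-! ### §1 The even zero-mass correction of an `L²_w` class -/

/-- `w⁻¹ = (L² + ξ²)⁻¹` lies in `L²_w` (`∫ w·w⁻² = ∫ w⁻¹ = π/L`). [folklore] -/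
theorem memLp_invWeight (hL : 0 < L) : MemLp (fun y : ℝ => (L ^ 2 + y ^ 2)⁻¹) 2 (μw L) := by
  refine memLp_W (by fun_prop) ?_
  refine (SheetRWeightedEmbeddings.integrable_inv_sq_add_sq hL).congr (Eventually.of_forall fun y => ?_)
  have hw : (0 : ℝ) < L ^ 2 + y ^ 2 := by positivity
  field_simp

/-- The even part `½(g + g∘(−·))` of `g ∈ L²_w` is reflection invariant. [folklore] -/
theorem reflW_evenW (g : W L) : reflW L ((1 / 2 : ℝ) • (g + reflW L g)) = (1 / 2 : ℝ) • (g + reflW L g) := by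
  rw [map_smul, map_add, reflW_reflW, add_comm]

/-- A class whose representative is a.e. even is reflection invariant. [folklore] -/
theorem reflW_eq_self_of_ae_even (hL : 0 < L) {ρ : W L} {f : ℝ → ℝ} (hρ : (ρ : ℝ → ℝ) =ᵐ[volume] f) (hf : ∀ y, f (-y) = f y) :
    reflW L ρ = ρ := by
  refine Lp.ext (ae_μw_of_ae_volume ?_)
  have hneg : (fun y => (ρ : ℝ → ℝ) (-y)) =ᵐ[volume] fun y => f (-y) := by
    have hmp : MeasurePreserving (Neg.neg : ℝ → ℝ) volume volume := Measure.measurePreserving_neg volume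
    exact hmp.quasiMeasurePreserving.ae_eq_comp hρ
  filter_upwards [reflW_ae_volume L hL ρ, hneg, hρ] with y h1 h2 h3
  rw [h1, h2, hf, h3]

/-- The even part pairs with an EVEN compactly supported test like `g` itself (`w` even): `∫ w·½(g + g∘(−·))·v = ∫ w·g·v`. [folklore] -/
theorem integral_weight_evenW_mul_test (hL : 0 < L) (g : W L) {v v₁ : ℝ → ℝ} (hv : IsCompactTestE v v₁) :
    ∫ y, (L ^ 2 + y ^ 2) * (((((1 / 2 : ℝ) • (g + reflW L g) : W L)) : ℝ → ℝ) y * v y) =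
      ∫ y, (L ^ 2 + y ^ 2) * ((g : ℝ → ℝ) y * v y) := by
  have hva := hv.toIsCompactTestAny
  have hae : ((((1 / 2 : ℝ) • (g + reflW L g) : W L)) : ℝ → ℝ) =ᵐ[volume] fun y => (1 / 2) * ((g : ℝ → ℝ) y + (g : ℝ → ℝ) (-y)) := by
    filter_upwards [ae_volume_of_ae_μw hL (Lp.coeFn_smul (1 / 2 : ℝ) (g + reflW L g)), ae_volume_of_ae_μw hL (Lp.coeFn_add g (reflW L g)),
      reflW_ae_volume L hL g] with y h1 h2 h3
    rw [h1, Pi.smul_apply, h2, Pi.add_apply, h3, smul_eq_mul]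
  have hI := (integrable_weight_mul_any hL g hva).1
  have hIr : Integrable fun y => (L ^ 2 + y ^ 2) * ((g : ℝ → ℝ) (-y) * v y) := by
    have h := (integrable_weight_mul_any hL (reflW L g) hva).1
    exact h.congr ((reflW_ae_volume L hL g).mono fun y hy => by simp only [hy])
  have e : ∫ y, (L ^ 2 + y ^ 2) * (((((1 / 2 : ℝ) • (g + reflW L g) : W L)) : ℝ → ℝ) y * v y) =
      ∫ y, (1 / 2 : ℝ) * ((L ^ 2 + y ^ 2) * ((g : ℝ → ℝ) y * v y)) + (1 / 2 : ℝ) * ((L ^ 2 + y ^ 2) * ((g : ℝ → ℝ) (-y) * v y)) := by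
    refine integral_congr_ae (hae.mono fun y hy => ?_)
    simp only [hy]; ring
  rw [e, integral_add (hI.const_mul _) (hIr.const_mul _), integral_const_mul, integral_const_mul]
  have hsym : ∫ y, (L ^ 2 + y ^ 2) * ((g : ℝ → ℝ) (-y) * v y) = ∫ y, (L ^ 2 + y ^ 2) * ((g : ℝ → ℝ) y * v y) := by
    rw [← integral_neg_eq_self (fun y => (L ^ 2 + y ^ 2) * ((g : ℝ → ℝ) (-y) * v y)) volume]
    refine integral_congr_ae (Eventually.of_forall fun y => ?_)
    show (L ^ 2 + (-y) ^ 2) * ((g : ℝ → ℝ) (- -y) * v (-y)) = (L ^ 2 + y ^ 2) * ((g : ℝ → ℝ) y * v y)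
    rw [neg_neg, hv.even y, neg_sq]
  rw [hsym]; ring

/-- `∫ w·ρ·v = ∫ v` when `ρ = w⁻¹` a.e.; in particular `= 0` on a zero-mass test. [folklore] -/
theorem integral_weight_invWeight_mul_test (hL : 0 < L) {ρ : W L} (hρ : (ρ : ℝ → ℝ) =ᵐ[volume] fun y => (L ^ 2 + y ^ 2)⁻¹) (v : ℝ → ℝ) :
    ∫ y, (L ^ 2 + y ^ 2) * ((ρ : ℝ → ℝ) y * v y) = ∫ y, v y := by
  refine integral_congr_ae (hρ.mono fun y hy => ?_)
  have hw : (0 : ℝ) < L ^ 2 + y ^ 2 := by positivity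
  simp only [hy]
  field_simp

/-- The mass of `w⁻¹` is `π/L`. [folklore] -/
theorem massW_invWeight (hL : 0 < L) {ρ : W L} (hρ : (ρ : ℝ → ℝ) =ᵐ[volume] fun y => (L ^ 2 + y ^ 2)⁻¹) : massW hL ρ = π / L := by
  rw [massW_apply, integral_congr_ae hρ, Literature.NumberTheory.LFunctions.ZeroDensity.integral_inv_sq_add_sq_real hL]

/-- **The even zero-mass correction lies in `WevenZ`.** For `g ∈ L²_w` and `ρ = w⁻¹`: `g_e − ((L/π)·∫g_e)·ρ ∈ WevenZ`, `g_e = ½(g + g∘(−·))`. [folklore] -/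
theorem evenZ_correction_mem (hL : 0 < L) (g : W L) {ρ : W L} (hρ : (ρ : ℝ → ℝ) =ᵐ[volume] fun y => (L ^ 2 + y ^ 2)⁻¹) :
    (1 / 2 : ℝ) • (g + reflW L g) - (L / π * massW hL ((1 / 2 : ℝ) • (g + reflW L g))) • ρ ∈ WevenZ hL := by
  have hρeven : reflW L ρ = ρ := reflW_eq_self_of_ae_even hL hρ fun y => by simp only [neg_sq]
  rw [mem_WevenZ_iff]
  refine ⟨by rw [map_sub, reflW_evenW, map_smul, hρeven], ?_⟩
  rw [← massW_apply hL, map_sub, map_smul (massW hL) (L / π * _) ρ, massW_invWeight hL hρ, smul_eq_mul]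
  have hπ : π ≠ 0 := Real.pi_pos.ne'
  have hL0 : L ≠ 0 := hL.ne'
  have key : ∀ M : ℝ, M - L / π * M * (π / L) = 0 := fun M => by
    have h1 : L / π * (π / L) = 1 := by rw [div_mul_div_comm, mul_comm L π, div_self (mul_ne_zero hπ hL0)]
    calc M - L / π * M * (π / L) = M - M * (L / π * (π / L)) := by ring
      _ = 0 := by rw [h1, mul_one, sub_self]
  exact key _

/-- **The even zero-mass correction pairs with every ZERO-MASS even test like `g`.** [folklore] -/
theorem integral_weight_correction_mul_test (hL : 0 < L) (g : W L) {ρ : W L} (hρ : (ρ : ℝ → ℝ) =ᵐ[volume] fun y => (L ^ 2 + y ^ 2)⁻¹)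
    {v v₁ : ℝ → ℝ} (hv : IsCompactTestE v v₁) (h0 : ∫ y, v y = 0) (c : ℝ) :
    ∫ y, (L ^ 2 + y ^ 2) * (((((1 / 2 : ℝ) • (g + reflW L g) - c • ρ : W L)) : ℝ → ℝ) y * v y) =
      ∫ y, (L ^ 2 + y ^ 2) * ((g : ℝ → ℝ) y * v y) := by
  have hva := hv.toIsCompactTestAny
  set ge : W L := (1 / 2 : ℝ) • (g + reflW L g) with hge
  have hae : (((ge - c • ρ : W L)) : ℝ → ℝ) =ᵐ[volume] fun y => (ge : ℝ → ℝ) y - c * (ρ : ℝ → ℝ) y := by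
    filter_upwards [ae_volume_of_ae_μw hL (Lp.coeFn_sub ge (c • ρ)), ae_volume_of_ae_μw hL (Lp.coeFn_smul c ρ)] with y h1 h2
    rw [h1, Pi.sub_apply, h2, Pi.smul_apply, smul_eq_mul]
  have hI1 := (integrable_weight_mul_any hL ge hva).1
  have hI2 := (integrable_weight_mul_any hL ρ hva).1
  have e : ∫ y, (L ^ 2 + y ^ 2) * ((((ge - c • ρ : W L)) : ℝ → ℝ) y * v y) =
      ∫ y, (L ^ 2 + y ^ 2) * ((ge : ℝ → ℝ) y * v y) - c * ((L ^ 2 + y ^ 2) * ((ρ : ℝ → ℝ) y * v y)) := by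
    refine integral_congr_ae (hae.mono fun y hy => ?_)
    simp only [hy]; ring
  rw [e, integral_sub hI1 (hI2.const_mul c), integral_const_mul, integral_weight_invWeight_mul_test hL hρ v, h0, mul_zero, sub_zero, hge,
    integral_weight_evenW_mul_test hL g hv]

/-! ### §2 Density of even zero-mass smooth compactly supported profiles in the even zero-mass class -/

/-- **Density lemma, smooth form.** If `g ∈ WevenZ hL` and `∫ w g φ = 0` for every even ZERO-MASS `φ ∈ C_c^∞(ℝ)`, then `g = 0`: by the smooth defect device
(`φ − (∫φ)·ρ` is such a test for every even `φ ∈ C_c^∞`) `∫ w g φ = C·∫φ` on all even smooth bumps, the even part of any bump is one and the odd part pairs to zero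
against the even `w·g`, so `w·g − C` annihilates `C_c^∞`; then `g = C·w⁻¹` a.e. and the zero-mass condition forces `C = 0`. [folklore] -/
theorem eq_zero_of_mem_WevenZ_smooth (hL : 0 < L) {g : W L} (hg : g ∈ WevenZ hL)
    (h : ∀ φ : ℝ → ℝ, ContDiff ℝ ∞ φ → HasCompactSupport φ → (∀ y, φ (-y) = φ y) → ∫ y, φ y = 0 →
      ∫ y, (L ^ 2 + y ^ 2) * ((g : ℝ → ℝ) y * φ y) = 0) : g = 0 := by
  rw [mem_WevenZ_iff_ae] at hg
  obtain ⟨heven, hmass⟩ := hg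
  set C : ℝ := ∫ y, (L ^ 2 + y ^ 2) * ((g : ℝ → ℝ) y * bumpFun y) with hC
  have hloc := locallyIntegrable_weight_mul hL g
  -- the smooth defect device: `∫ w g φ = C ∫ φ` for every even smooth bump `φ`
  have hext : ∀ φ : ℝ → ℝ, ContDiff ℝ ∞ φ → HasCompactSupport φ → (∀ y, φ (-y) = φ y) →
      ∫ y, (L ^ 2 + y ^ 2) * ((g : ℝ → ℝ) y * φ y) = C * ∫ y, φ y := by
    intro φ hφ hφc hφe
    set M : ℝ := ∫ y, φ y with hM
    have h0C : ContDiff ℝ ∞ fun x => φ x - M * bumpFun x := hφ.sub (contDiff_const.mul contDiff_bumpFun)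
    have h0S : HasCompactSupport fun x => φ x - M * bumpFun x := hφc.sub hasCompactSupport_bumpFun.mul_left
    have h0E : ∀ y, (fun x => φ x - M * bumpFun x) (-y) = (fun x => φ x - M * bumpFun x) y := fun y => by
      simp only [hφe y, bumpFun_even y]
    have hφi : Integrable φ := hφ.continuous.integrable_of_hasCompactSupport hφc
    have hbi : Integrable bumpFun := (contDiff_bumpFun (n := 0)).continuous.integrable_of_hasCompactSupport hasCompactSupport_bumpFun
    have h0M : ∫ y, (fun x => φ x - M * bumpFun x) y = 0 := by
      show ∫ y, (φ y - M * bumpFun y) = 0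
      rw [integral_sub hφi (hbi.const_mul M), integral_const_mul, integral_bumpFun, mul_one, hM, sub_self]
    have hzero := h _ h0C h0S h0E h0M
    have hIφ := (integrable_weight_mul_any hL g (isCompactTestE_of_smooth_even hφ hφc hφe).toIsCompactTestAny).1
    have hIb := (integrable_weight_mul_any hL g isCompactTestE_bump.toIsCompactTestAny).1
    have e : ∫ y, (L ^ 2 + y ^ 2) * ((g : ℝ → ℝ) y * (fun x => φ x - M * bumpFun x) y) =
        ∫ y, (L ^ 2 + y ^ 2) * ((g : ℝ → ℝ) y * φ y) - M * ((L ^ 2 + y ^ 2) * ((g : ℝ → ℝ) y * bumpFun y)) :=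
      integral_congr_ae (Eventually.of_forall fun y => by simp only; ring)
    rw [e, integral_sub hIφ (hIb.const_mul M), integral_const_mul] at hzero
    rw [hC]; linarith
  have hlocC : LocallyIntegrable (fun y => (L ^ 2 + y ^ 2) * (g : ℝ → ℝ) y - C) volume := hloc.sub (locallyIntegrable_const C)
  -- `w g − C` annihilates every smooth bump
  have hae : ∀ᵐ y ∂volume, (L ^ 2 + y ^ 2) * (g : ℝ → ℝ) y - C = 0 := by
    refine ae_eq_zero_of_integral_contDiff_smul_eq_zero hlocC fun ψ hψ hsupp => ?_
    have hψc : Continuous ψ := hψ.continuous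
    have hψn : Continuous fun x => ψ (-x) := hψc.comp continuous_neg
    have hsuppn : HasCompactSupport fun x => ψ (-x) := hsupp.comp_homeomorph (Homeomorph.neg ℝ)
    have hψi : Integrable ψ := hψc.integrable_of_hasCompactSupport hsupp
    have hψni : Integrable fun x => ψ (-x) := hψn.integrable_of_hasCompactSupport hsuppn
    -- the even part of `ψ` is an even smooth bump
    have heC : ContDiff ℝ ∞ fun x => (ψ x + ψ (-x)) / 2 := (hψ.add (hψ.comp contDiff_neg)).div_const 2
    have heS : HasCompactSupport fun x => (ψ x + ψ (-x)) / 2 := by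
      have e : (fun x => (ψ x + ψ (-x)) / 2) = fun x => (1 / 2 : ℝ) * (ψ x + ψ (-x)) := by funext x; ring
      rw [e]
      exact (hsupp.add hsuppn).mul_left
    have heE : ∀ y, (fun x => (ψ x + ψ (-x)) / 2) (-y) = (fun x => (ψ x + ψ (-x)) / 2) y := fun y => by
      simp only [neg_neg]; ring
    have hevenpart := hext _ heC heS heE
    have hI1 : Integrable (fun y => ψ y • ((L ^ 2 + y ^ 2) * (g : ℝ → ℝ) y)) := hloc.integrable_smul_left_of_hasCompactSupport hψc hsupp
    have hI2 : Integrable (fun y => ψ (-y) • ((L ^ 2 + y ^ 2) * (g : ℝ → ℝ) y)) :=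
      hloc.integrable_smul_left_of_hasCompactSupport hψn hsuppn
    have hIo : Integrable (fun y => ((ψ y - ψ (-y)) / 2) * ((L ^ 2 + y ^ 2) * (g : ℝ → ℝ) y)) :=
      ((hI1.sub hI2).div_const 2).congr (Eventually.of_forall fun y => by simp only [smul_eq_mul, Pi.sub_apply]; ring)
    have hIe : Integrable (fun y => ((ψ y + ψ (-y)) / 2) * ((L ^ 2 + y ^ 2) * (g : ℝ → ℝ) y)) :=
      ((hI1.add hI2).div_const 2).congr (Eventually.of_forall fun y => by simp only [smul_eq_mul, Pi.add_apply]; ring)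
    have hIC : Integrable (fun y => ψ y * C) := hψi.mul_const C
    have hsplit : (fun y => ψ y • ((L ^ 2 + y ^ 2) * (g : ℝ → ℝ) y - C)) = fun y =>
        ((ψ y - ψ (-y)) / 2) * ((L ^ 2 + y ^ 2) * (g : ℝ → ℝ) y) + ((ψ y + ψ (-y)) / 2) * ((L ^ 2 + y ^ 2) * (g : ℝ → ℝ) y)
          - ψ y * C := by
      funext y; simp only [smul_eq_mul]; ring
    have hIoe : Integrable (fun y => ((ψ y - ψ (-y)) / 2) * ((L ^ 2 + y ^ 2) * (g : ℝ → ℝ) y)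
        + ((ψ y + ψ (-y)) / 2) * ((L ^ 2 + y ^ 2) * (g : ℝ → ℝ) y)) := hIo.add hIe
    rw [hsplit, integral_sub hIoe hIC, integral_add hIo hIe]
    -- odd part: integrand odd (`w g` is a.e. even)
    have h1 : ∫ y, ((ψ y - ψ (-y)) / 2) * ((L ^ 2 + y ^ 2) * (g : ℝ → ℝ) y) = 0 := by
      refine integral_eq_zero_of_ae_odd ?_
      filter_upwards [heven] with y hy
      simp only [neg_neg, neg_sq, hy]
      ring
    -- even part: an even smooth bump, so the pairing is `C · ∫(even part)`
    have h2 : ∫ y, ((ψ y + ψ (-y)) / 2) * ((L ^ 2 + y ^ 2) * (g : ℝ → ℝ) y) = C * ∫ y, (ψ y + ψ (-y)) / 2 := by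
      rw [← hevenpart]
      refine integral_congr_ae (Eventually.of_forall fun y => ?_)
      simp only; ring
    -- `∫ ψ = ∫ (even part)` (the odd part has integral zero)
    have h3 : ∫ y, ψ y * C = C * ∫ y, (ψ y + ψ (-y)) / 2 := by
      rw [integral_mul_const, mul_comm]
      congr 1
      have hn : ∫ y, ψ (-y) = ∫ y, ψ y := integral_neg_eq_self ψ volume
      rw [integral_div, integral_add hψi hψni, hn]
      ring
    rw [h1, h2, h3]; ring
  -- hence `g = C·w⁻¹` a.e.; zero mass forces `C = 0`
  have hgC : (g : ℝ → ℝ) =ᵐ[volume] fun y => C * (L ^ 2 + y ^ 2)⁻¹ := by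
    filter_upwards [hae] with y hy
    have hw : 0 < L ^ 2 + y ^ 2 := by positivity
    field_simp
    linarith
  have hint : ∫ y, (g : ℝ → ℝ) y = C * (π / L) := by
    rw [integral_congr_ae hgC, integral_const_mul, Literature.NumberTheory.LFunctions.ZeroDensity.integral_inv_sq_add_sq_real hL]
  have hC0 : C = 0 := by
    rw [hmass] at hint
    have hπ : 0 < π / L := div_pos Real.pi_pos hL
    rcases mul_eq_zero.1 hint.symm with h0 | h0
    · exact h0
    · exact absurd h0 hπ.ne'
  have hg0 : (g : ℝ → ℝ) =ᵐ[volume] 0 := by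
    filter_upwards [hgC] with y hy
    rw [hy, hC0, zero_mul, Pi.zero_apply]
  exact (Lp.eq_zero_iff_ae_eq_zero).2 (ae_μw_of_ae_volume hg0)

/-! ### §3 The local part on a smooth compactly supported profile, PARITY-FREE test -/

variable {d V : ℝ → ℝ} {D₀ D₁ V₀ : ℝ}

/-- **The weak form of the local operator on a smooth compactly supported profile, against a parity-free test** is the pairing with `−φ″ + dφ′ + Vφ`:
for `φ ∈ C²` with compact support and every compactly supported PARITY-FREE test, `linForm L d V φ φ′ v v₁ = ∫ w·(−φ″ + dφ′ + Vφ)·v` (one integration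
by parts, cert-5's `integral_deriv_mul_testAny`; twin of `SheetRGeneratorOddDense.linForm_smooth_eq_integral`). [folklore] -/
theorem linForm_smooth_eq_integral_any (hL : 0 < L) (hdm : AEStronglyMeasurable d volume) (hVm : AEStronglyMeasurable V volume) (hD₀ : 0 ≤ D₀)
    (hD₁ : 0 ≤ D₁) (hd : ∀ ξ, |d ξ| ≤ D₀ + D₁ * |ξ|) (hV : ∀ ξ, |V ξ| ≤ V₀) {φ : ℝ → ℝ} (hφ : ContDiff ℝ 2 φ) (hφc : HasCompactSupport φ)
    {v v₁ : ℝ → ℝ} (hv : IsCompactTestAny v v₁) :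
    linForm L d V φ (deriv φ) v v₁ = ∫ y, (L ^ 2 + y ^ 2) * ((-deriv (deriv φ) y + d y * deriv φ y + V y * φ y) * v y) := by
  obtain ⟨hvc, -, -, hvK⟩ := basic_of_any hv
  have hφ1 : ContDiff ℝ 1 (deriv φ) := (contDiff_succ_iff_deriv.1 hφ).2.2
  have hc0 : Continuous φ := hφ.continuous
  have hc1 : Continuous (deriv φ) := hφ1.continuous
  have hd1 : ∀ y, HasDerivAt (deriv φ) (deriv (deriv φ) y) y := fun y => ((hφ1.differentiable one_ne_zero) y).hasDerivAt
  -- weights of `φ`, `φ′` (continuous with compact support)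
  have hw0 : Integrable fun y => (L ^ 2 + y ^ 2) * φ y ^ 2 := by
    have e : (fun y => (L ^ 2 + y ^ 2) * φ y ^ 2) = (fun y => (L ^ 2 + y ^ 2) * φ y) * φ := by funext y; simp only [Pi.mul_apply]; ring
    rw [e]; exact Continuous.integrable_of_hasCompactSupport (by fun_prop) hφc.mul_left
  have hw1 : Integrable fun y => (L ^ 2 + y ^ 2) * deriv φ y ^ 2 := by
    have e : (fun y => (L ^ 2 + y ^ 2) * deriv φ y ^ 2) = (fun y => (L ^ 2 + y ^ 2) * deriv φ y) * deriv φ := by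
      funext y; simp only [Pi.mul_apply]; ring
    rw [e]; exact Continuous.integrable_of_hasCompactSupport (by fun_prop) hφc.deriv.mul_left
  obtain ⟨hI, -⟩ := abs_linForm_le_any (d := d) (V := V) hL hdm hVm hD₁ hd hV hv hc0.aestronglyMeasurable hc1.aestronglyMeasurable hw0 hw1
  -- the multiplier `g = w·φ′` and integration by parts
  set g : ℝ → ℝ := fun y => (L ^ 2 + y ^ 2) * deriv φ y with hg
  have hgC : ContDiff ℝ 1 g := by rw [hg]; exact (by fun_prop : ContDiff ℝ 1 fun y : ℝ => L ^ 2 + y ^ 2).mul hφ1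
  have hgd : ∀ y, deriv g y = 2 * y * deriv φ y + (L ^ 2 + y ^ 2) * deriv (deriv φ) y := by
    intro y
    have hw : HasDerivAt (fun y : ℝ => L ^ 2 + y ^ 2) (2 * y) y := by
      have := ((hasDerivAt_id y).pow 2).const_add (L ^ 2)
      simpa using this
    have h : HasDerivAt (fun y => (L ^ 2 + y ^ 2) * deriv φ y) (2 * y * deriv φ y + (L ^ 2 + y ^ 2) * deriv (deriv φ) y) y := hw.mul (hd1 y)
    rw [hg, h.deriv]
  have hA := integral_deriv_mul_testAny hgC hv
  have hG2 : Integrable fun y => deriv g y * v y := Continuous.integrable_of_hasCompactSupport ((hgC.continuous_deriv le_rfl).mul hvc) hvK.mul_left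
  have key : ∀ y, ((L ^ 2 + y ^ 2) * (deriv φ y * v₁ y) + 2 * y * (deriv φ y * v y) + (L ^ 2 + y ^ 2) * d y * (deriv φ y * v y)
        + (L ^ 2 + y ^ 2) * V y * (φ y * v y))
      - (L ^ 2 + y ^ 2) * ((-deriv (deriv φ) y + d y * deriv φ y + V y * φ y) * v y) = (L ^ 2 + y ^ 2) * deriv φ y * v₁ y + deriv g y * v y := by
    intro y; rw [hgd y]; ring
  have hT : Integrable fun y => (L ^ 2 + y ^ 2) * ((-deriv (deriv φ) y + d y * deriv φ y + V y * φ y) * v y) := by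
    have hq := memLp_local_smooth (L := L) hdm hVm hD₀ hD₁ hd hV hφ hφc
    have h := (integrable_weight_mul_any hL (hq.toLp _) hv).1
    refine h.congr ?_
    filter_upwards [ae_volume_of_ae_μw hL (MemLp.coeFn_toLp hq)] with y hy
    rw [hy]
  have hG1 : Integrable fun y => (L ^ 2 + y ^ 2) * deriv φ y * v₁ y := by
    refine ((hI.sub hT).sub hG2).congr (Eventually.of_forall fun y => ?_)
    simp only [Pi.sub_apply]
    linarith [key y]
  have hlin : linForm L d V φ (deriv φ) v v₁ =
      ∫ y, ((L ^ 2 + y ^ 2) * (deriv φ y * v₁ y) + 2 * y * (deriv φ y * v y) + (L ^ 2 + y ^ 2) * d y * (deriv φ y * v y)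
          + (L ^ 2 + y ^ 2) * V y * (φ y * v y)) := rfl
  have eSub := integral_sub hI hT
  have eKey : ∫ y, (((L ^ 2 + y ^ 2) * (deriv φ y * v₁ y) + 2 * y * (deriv φ y * v y) + (L ^ 2 + y ^ 2) * d y * (deriv φ y * v y)
        + (L ^ 2 + y ^ 2) * V y * (φ y * v y))
      - (L ^ 2 + y ^ 2) * ((-deriv (deriv φ) y + d y * deriv φ y + V y * φ y) * v y)) =
      (∫ y, (L ^ 2 + y ^ 2) * deriv φ y * v₁ y) + ∫ y, deriv g y * v y := by
    rw [← integral_add hG1 hG2]; exact integral_congr_ae (Eventually.of_forall key)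
  have hgφ : ∫ y, g y * v₁ y = ∫ y, (L ^ 2 + y ^ 2) * deriv φ y * v₁ y := rfl
  rw [hlin]
  linarith

end SheetREvenZeroMassCorrection
end Summit.NavierStokesRegularity.OSWSelfSimilar

end
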